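import Summits.MatrixMultiplication.MatrixMultiplication.Theorems.FarEdgeDescentPermStarClassesPow
import HarnessLib

/-!
# `(𝔖^♭)^{⊠N} ⋭ (𝔖^ᵀ)^{⊠N}` for every `N ≥ 1` — a seventh all-level antichain edge

Route `FarEdgeDescent` (cell `decomp-mm`, lens 2 «structural dichotomy (special vs generic)»,
gen 32), Kernel VII; support for the aside `SubLogRate` (stmt-MatrixMultiplication-25371).

`FarEdgeDescentSignTwistCommPow` showed that the `y`-pencil commutant of `(𝔖^♭ᵀ)^{⊠N}` is
scalar while that of `(𝔖^♭)^{⊠N}` contains `2^N` independent pairs, whence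
`(𝔖^♭)^{⊠N} ⋭ (𝔖^♭ᵀ)^{⊠N}` (BCS (15.19)).  The scalar-commutant argument used only the SUPPORT
PATTERN of `𝔖^♭ᵀ` — `𝔖^♭ᵀ(a,x,c) = [side a = side c ∧ x = bOf a c] · wt(a,c)` with non-vanishing
weights — and the twisted star `𝔖^ᵀ = twistedStar K 2 1` has the same pattern with all weights
`1` (`twistedStar_pattern`).  This file runs the argument for an ARBITRARY non-vanishing weight
on that pattern (`β_offdiag`, `γ_offdiag`, `γ_diag`, `β_diag`) and concludes

  `signStar_pow_not_algDegeneratesTo_twistedStar_pow`: `(𝔖^♭)^{⊠N} ⋭ (𝔖^ᵀ)^{⊠N}` (`N ≥ 1`, every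
  field),

one of the six "downward" edges that `FarEdgeDescentGenericAntichain` had only at `N = 1` (there
via the `y`-pencil determinant class, characteristic `≠ 2`).  Tally after this file
(`allN_antichain_edges₇`): seven of the twelve ordered non-degenerations among
`⟨2,2,2⟩, 𝔖^ᵀ, 𝔖^♭, 𝔖^♭ᵀ` hold at every Kronecker level; the remaining five
(`𝔖^ᵀ, 𝔖^♭, 𝔖^♭ᵀ ⋭ ⟨2,2,2⟩`, `𝔖^♭ᵀ ⋭ 𝔖^ᵀ`, `𝔖^♭ᵀ ⋭ 𝔖^♭` at `N ≥ 2`) stay open — in each the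
would-be source has commutants and orbit at most as large as the target's in every slot, so
neither BCS (15.19) nor orbit dimension can decide them.

References: P. Bürgisser, M. Clausen, M. A. Shokrollahi, *Algebraic Complexity Theory* (1997),
(15.19), §20.2 [BurgisserClausenShokrollahi1997]; H. Cohn, C. Umans, SODA 2013, §3
[CohnUmans2013].
-/

noncomputable section

open scoped BigOperators

set_option linter.dupNamespace false

namespace Summit.MatrixMultiplication.MatrixMultiplication.Theorems.FarEdgeDescentTwistCommPow

open Literature.Computability.AlgebraicComplexity
open Summit.MatrixMultiplication.MatrixMultiplication.Theorems.FarEdgeDescentCommutantObstruction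
open Summit.MatrixMultiplication.MatrixMultiplication.Theorems.FarEdgeDescentTwistedStar
open Summit.MatrixMultiplication.MatrixMultiplication.Theorems.FarEdgeDescentTwistRigidity
open Summit.MatrixMultiplication.MatrixMultiplication.Theorems.FarEdgeDescentSignTwist
open Summit.MatrixMultiplication.MatrixMultiplication.Theorems.FarEdgeDescentSignTwistDet
open Summit.MatrixMultiplication.MatrixMultiplication.Theorems.FarEdgeDescentSignTwistComm
open Summit.MatrixMultiplication.MatrixMultiplication.Theorems.FarEdgeDescentSignTwistCommPow

universe u

/-! ## The support pattern with arbitrary non-vanishing weights -/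

section Pattern
variable {K : Type u} [Field K] {N : ℕ} {T : Leaf2 → (Fin 2 × Fin 2) → Leaf2 → K}
  {w : Leaf2 → Leaf2 → K}
  (hT : ∀ a x c, T a x c = if side a = side c ∧ x = bOf a c then w a c else 0)
  (hw : ∀ a c, w a c ≠ 0)
include hT

/-- Coordinatewise vanishing of a Kronecker-power entry. [folklore] -/
theorem prod_eq_zero_of {a c : Fin N → Leaf2} {x : Fin N → Fin 2 × Fin 2} (i : Fin N)
    (h : ¬ (side (a i) = side (c i) ∧ x i = bOf (a i) (c i))) :
    ∏ j, T (a j) (x j) (c j) = 0 :=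
  Finset.prod_eq_zero (Finset.mem_univ i) (by rw [hT, if_neg h])

/-- The supported Kronecker-power entries. [folklore] -/
theorem prod_eq_wt {a c : Fin N → Leaf2} {x : Fin N → Fin 2 × Fin 2}
    (h : ∀ j, side (a j) = side (c j) ∧ x j = bOf (a j) (c j)) :
    ∏ j, T (a j) (x j) (c j) = ∏ j, w (a j) (c j) :=
  Finset.prod_congr rfl fun j _ => by rw [hT, if_pos (h j)]

omit hT in
include hw in
/-- The supported entries are nonzero. [folklore] -/
theorem prod_w_ne_zero (a c : Fin N → Leaf2) : ∏ j, w (a j) (c j) ≠ 0 :=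
  Finset.prod_ne_zero_iff.mpr fun _ _ => hw _ _

variable {β' : Matrix (Fin N → Fin 2 × Fin 2) (Fin N → Fin 2 × Fin 2) K}
  {γ' : Matrix (Fin N → Leaf2) (Fin N → Leaf2) K}
  (H : ∀ c, β' * slice (kroneckerPow (rot T) N) c = slice (kroneckerPow (rot T) N) c * γ')
include hw H

omit hT hw in
/-- Entries of the commutation relation. [folklore] -/
theorem entry_eq (c : Fin N → Leaf2) (b : Fin N → Fin 2 × Fin 2) (a : Fin N → Leaf2) :
    ∑ x, β' b x * ∏ i, T (a i) (x i) (c i) = ∑ y, (∏ i, T (y i) (b i) (c i)) * γ' y a := by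
  have h := congr_fun (congr_fun (H c) b) a
  simpa only [Matrix.mul_apply, slice_apply, kroneckerPow_apply, rot_apply] using h

/-- **Step 1: `β'` is diagonal.** [folklore] -/
theorem β_offdiag {b b'' : Fin N → Fin 2 × Fin 2} (hne : b ≠ b'') : β' b b'' = 0 := by
  obtain ⟨i₀, hi₀⟩ := Function.ne_iff.mp hne
  have h := entry_eq H (fun i => (sepAC (b'' i) (b i)).2) b (fun i => (sepAC (b'' i) (b i)).1)
  rw [Fintype.sum_eq_single b'', prod_eq_wt hT
      (fun j => ⟨side_sepAC _ _, (bOf_sepAC _ _).symm⟩), Finset.sum_eq_zero] at h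
  · exact (mul_eq_zero.mp h).resolve_right (prod_w_ne_zero hw _ _)
  · intro y _
    rw [prod_eq_zero_of hT i₀ (sepAC_sep hi₀ (y i₀)), zero_mul]
  · intro x hx
    obtain ⟨i₁, hi₁⟩ := Function.ne_iff.mp hx
    rw [prod_eq_zero_of hT i₁ (fun h' => hi₁ (h'.2.trans (bOf_sepAC _ _))), mul_zero]

/-- **Step 2: the key identity** for `b = bOf(a⁰, c)` coordinatewise. [folklore] -/
theorem key_identity (a₀ c : Fin N → Leaf2) (hs : ∀ i, side (a₀ i) = side (c i))
    (a : Fin N → Leaf2) :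
    β' (fun i => bOf (a₀ i) (c i)) (fun i => bOf (a₀ i) (c i)) *
        ∏ i, T (a i) (bOf (a₀ i) (c i)) (c i) =
      (∏ i, w (a₀ i) (c i)) * γ' a₀ a := by
  have h := entry_eq H c (fun i => bOf (a₀ i) (c i)) a
  rw [Fintype.sum_eq_single (fun i => bOf (a₀ i) (c i)), Fintype.sum_eq_single a₀,
    prod_eq_wt hT (fun j => ⟨hs j, rfl⟩)] at h
  · exact h
  · intro y hy
    obtain ⟨i₁, hi₁⟩ := Function.ne_iff.mp hy
    rw [prod_eq_zero_of hT i₁ (fun h' => hi₁ (eq_of_bOf_eq h'.1 (hs i₁) h'.2.symm)), zero_mul]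
  · intro x hx
    rw [β_offdiag hT hw H (Ne.symm hx), zero_mul]

/-- `γ'` vanishes off the diagonal. [folklore] -/
theorem γ_offdiag {a₀ a : Fin N → Leaf2} (hne : a ≠ a₀) : γ' a₀ a = 0 := by
  have h := key_identity hT hw H a₀ a₀ (fun _ => rfl) a
  obtain ⟨i₁, hi₁⟩ := Function.ne_iff.mp hne
  rw [prod_eq_zero_of hT i₁ (fun h' => hi₁ (eq_of_bOf_eq h'.1 rfl h'.2.symm)), mul_zero] at h
  exact (mul_eq_zero.mp h.symm).resolve_left (prod_w_ne_zero hw _ _)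

/-- Diagonal entries of `γ'` are diagonal entries of `β'`. [folklore] -/
theorem γ_diag (a₀ c : Fin N → Leaf2) (hs : ∀ i, side (a₀ i) = side (c i)) :
    γ' a₀ a₀ = β' (fun i => bOf (a₀ i) (c i)) (fun i => bOf (a₀ i) (c i)) := by
  have h := key_identity hT hw H a₀ c hs a₀
  rw [prod_eq_wt hT (fun j => ⟨hs j, rfl⟩), mul_comm] at h
  exact (mul_left_cancel₀ (prod_w_ne_zero hw _ _) h).symm

/-- **Step 3: all diagonal entries of `β'` agree.** [folklore] -/
theorem β_diag (b : Fin N → Fin 2 × Fin 2) :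
    β' b b = β' (fun _ => (0, 0)) (fun _ => (0, 0)) := by
  have h1 := γ_diag hT hw H (fun i => (Sum.inl ((b i).1, 0) : Leaf2))
    (fun i => Sum.inl ((b i).2, 0)) (fun _ => rfl)
  have h2 := γ_diag hT hw H (fun i => (Sum.inl ((b i).1, 0) : Leaf2)) (fun _ => Sum.inl (0, 0))
    (fun _ => rfl)
  have h3 := γ_diag hT hw H (fun _ => (Sum.inr (0, 0) : Leaf2)) (fun i => Sum.inr ((b i).1, 0))
    (fun _ => rfl)
  have h4 := γ_diag hT hw H (fun _ => (Sum.inr (0, 0) : Leaf2)) (fun _ => Sum.inr (0, 0))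
    (fun _ => rfl)
  simp only [bOf, Prod.mk.eta] at h1 h2 h3 h4
  rw [← h1, h2, ← h3, h4]

end Pattern

/-! ## The twisted star has the `♭ᵀ`-pattern with unit weights -/

section Twisted
variable (K : Type u) [Field K]

/-- **Closed form**: `𝔖^ᵀ(a, x, c) = [side a = side c ∧ x = bOf a c]` (`n = 2`, `L = 1`).
[folklore] -/
theorem twistedStar_pattern (a : Leaf2) (x : Fin 2 × Fin 2) (c : Leaf2) :
    twistedStar K 2 1 a x c = if side a = side c ∧ x = bOf a c then (1 : K) else 0 := by
  obtain ⟨x₁, x₂⟩ := x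
  rcases a with ⟨i, l⟩ | ⟨i, l⟩ <;> rcases c with ⟨k, l'⟩ | ⟨k, l'⟩
  · obtain rfl : l = 0 := Subsingleton.elim _ _
    obtain rfl : l' = 0 := Subsingleton.elim _ _
    fin_cases i <;> fin_cases k <;> fin_cases x₁ <;> fin_cases x₂ <;>
      simp [matMulTensor, side, bOf]
  · simp [side]
  · simp [side]
  · obtain rfl : l = 0 := Subsingleton.elim _ _
    obtain rfl : l' = 0 := Subsingleton.elim _ _
    fin_cases i <;> fin_cases k <;> fin_cases x₁ <;> fin_cases x₂ <;>
      simp [matMulTensor, side, bOf]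

/-- **The `y`-pencil commutant of `(𝔖^ᵀ)^{⊠N}` is scalar** (every field, every `N`): the
pattern lemmas above at unit weights. [cite: BurgisserClausenShokrollahi1997, (15.19)] -/
theorem comm_twistedStar_pow {N : ℕ}
    {β' : Matrix (Fin N → Fin 2 × Fin 2) (Fin N → Fin 2 × Fin 2) K}
    {γ' : Matrix (Fin N → Leaf2) (Fin N → Leaf2) K}
    (H : ∀ c, β' * slice (kroneckerPow (rot (twistedStar K 2 1)) N) c =
      slice (kroneckerPow (rot (twistedStar K 2 1)) N) c * γ') :
    β' = β' (fun _ => (0, 0)) (fun _ => (0, 0)) • (1 : Matrix _ _ K) ∧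
      γ' = β' (fun _ => (0, 0)) (fun _ => (0, 0)) • (1 : Matrix _ _ K) := by
  have hT := twistedStar_pattern K
  have hw : ∀ _a _c : Leaf2, (fun _ _ => (1 : K)) _a _c ≠ 0 := fun _ _ => one_ne_zero
  constructor
  · ext b x
    by_cases hbx : b = x
    · subst hbx; simp [β_diag hT hw H b]
    · simp [hbx, β_offdiag hT hw H hbx]
  · ext y a
    by_cases hya : y = a
    · subst hya
      rw [γ_diag hT hw H y y (fun _ => rfl), β_diag hT hw H]
      simp
    · simp [hya, γ_offdiag hT hw H (Ne.symm hya)]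

/-! ## The theorem -/

/-- **`(𝔖^♭)^{⊠N} ⋭ (𝔖^ᵀ)^{⊠N}` for every `N ≥ 1`, over every field**: the `y`-pencil commutant
of `(𝔖^♭)^{⊠N}` contains the `2^N` independent pairs `(βP r, γP r)`, that of `(𝔖^ᵀ)^{⊠N}` only
scalars, and commutants only grow under degeneration (BCS (15.19)).
[cite: BurgisserClausenShokrollahi1997, (15.19), sec. 20.2] -/
theorem signStar_pow_not_algDegeneratesTo_twistedStar_pow (N : ℕ) (hN : 1 ≤ N) :
    ¬ AlgDegeneratesTo (kroneckerPow (signStar K) N) (kroneckerPow (twistedStar K 2 1) N) := by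
  intro h
  have h' : AlgDegeneratesTo (kroneckerPow (rot (signStar K)) N)
      (kroneckerPow (rot (twistedStar K 2 1)) N) := algDegeneratesTo_rot h
  set x : Matrix (Fin N → Fin 2 × Fin 2) (Fin N → Fin 2 × Fin 2) K ×
      Matrix (Fin N → Leaf2) (Fin N → Leaf2) K := (1, 1) with hx
  refine not_algDegeneratesTo_of_commutant (R₀ := Fin N → Fin 2) _ _ (βP K N) (γP K N)
    (hcomm_signStar_pow K N) (βP_linearIndependent K N) (K ∙ x) ?_ ?_ h'
  · intro β' γ' H
    obtain ⟨hb, hg⟩ := comm_twistedStar_pow K H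
    rw [Submodule.mem_span_singleton]
    exact ⟨β' (fun _ => (0, 0)) (fun _ => (0, 0)), by rw [hx, Prod.smul_mk, ← hb, ← hg]⟩
  · calc Module.finrank K (K ∙ x) ≤ 1 := (finrank_span_le_card ({x} : Set _)).trans (by simp)
      _ < Fintype.card (Fin N → Fin 2) := by
        rw [Fintype.card_fun, Fintype.card_fin, Fintype.card_fin]
        exact Nat.one_lt_two_pow (by omega)

/-- Nor does any power of `𝔖^♭` RESTRICT to the same power of `𝔖^ᵀ`. [folklore] -/
theorem signStar_pow_not_restrictsTo_twistedStar_pow (N : ℕ) (hN : 1 ≤ N) :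
    ¬ TensorRestrictsTo (kroneckerPow (signStar K) N) (kroneckerPow (twistedStar K 2 1) N) :=
  fun h => signStar_pow_not_algDegeneratesTo_twistedStar_pow K N hN h.algDegeneratesTo

/-- `𝔖^♭` and `𝔖^ᵀ` have DEGENERATION-incomparable `N`-th powers for every `N ≥ 1` (every field):
the first generic pair decided in both directions at all levels.
[cite: BurgisserClausenShokrollahi1997, (15.19)] -/
theorem signStar_twistedStar_pow_incomparable (N : ℕ) (hN : 1 ≤ N) :
    ¬ AlgDegeneratesTo (kroneckerPow (signStar K) N) (kroneckerPow (twistedStar K 2 1) N) ∧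
      ¬ AlgDegeneratesTo (kroneckerPow (twistedStar K 2 1) N) (kroneckerPow (signStar K) N) :=
  ⟨signStar_pow_not_algDegeneratesTo_twistedStar_pow K N hN,
    twistedStar_pow_not_algDegeneratesTo_signStar N hN⟩

/-- **Seven antichain edges at every level `N ≥ 1`** (characteristic `≠ 2` where `⟨2,2,2⟩` meets a
sign twist or `𝔖^ᵀ` meets `𝔖^♭ᵀ`): `⟨2,2,2⟩^{⊠N} ⋭ (𝔖^ᵀ)^{⊠N}, (𝔖^♭)^{⊠N}, (𝔖^♭ᵀ)^{⊠N}`;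
`(𝔖^ᵀ)^{⊠N} ⋭ (𝔖^♭)^{⊠N}, (𝔖^♭ᵀ)^{⊠N}`; `(𝔖^♭)^{⊠N} ⋭ (𝔖^♭ᵀ)^{⊠N}, (𝔖^ᵀ)^{⊠N}`.
[cite: BurgisserClausenShokrollahi1997, (15.19), sec. 20.2] -/
theorem allN_antichain_edges₇ (h2 : (2 : K) ≠ 0) (N : ℕ) (hN : 1 ≤ N) :
    ¬ AlgDegeneratesTo (kroneckerPow (matMulTensor K 2 2 (1 + 1)) N)
        (kroneckerPow (twistedStar K 2 1) N) ∧
    ¬ AlgDegeneratesTo (kroneckerPow (matMulTensor K 2 2 (1 + 1)) N)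
        (kroneckerPow (signStar K) N) ∧
    ¬ AlgDegeneratesTo (kroneckerPow (matMulTensor K 2 2 (1 + 1)) N)
        (kroneckerPow (signTStar K) N) ∧
    ¬ AlgDegeneratesTo (kroneckerPow (twistedStar K 2 1) N) (kroneckerPow (signStar K) N) ∧
    ¬ AlgDegeneratesTo (kroneckerPow (twistedStar K 2 1) N) (kroneckerPow (signTStar K) N) ∧
    ¬ AlgDegeneratesTo (kroneckerPow (signStar K) N) (kroneckerPow (signTStar K) N) ∧
    ¬ AlgDegeneratesTo (kroneckerPow (signStar K) N) (kroneckerPow (twistedStar K 2 1) N) := by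
  have hT := matMul_pow_not_algDegeneratesTo_permStar_pow (K := K) (L := 1) (N := N)
    (not_isProdPerm_prodComm (n := 2) le_rfl) le_rfl hN
  rw [permStar_prodComm] at hT
  obtain ⟨h1, h2', h3, h4, h5⟩ := allN_antichain_edges K h2 N hN
  exact ⟨hT, h1, h2', h3, h4, h5, signStar_pow_not_algDegeneratesTo_twistedStar_pow K N hN⟩

end Twisted

end Summit.MatrixMultiplication.MatrixMultiplication.Theorems.FarEdgeDescentTwistCommPow

end
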